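import Literature.MathematicalPhysics.QuantumFieldTheory.Balaban1983to89.B9ResidualEntriesAtOneAtLetters

/-!
# `Balaban1983to89.B9Cor35ComparisonsEHAtLetters` — [B9] Cor. 3.5 (p. 407) AT NODE 00's OPERATOR LAYER OF LETTERS: the two NULL READINGS
# `hE4`, `hH2` of the N06 knit PROVED at `ops := Node00.opsYOfLetters N θ M⋆ 𝔏 𝔈` for EVERY letter record `𝔏` — and the complete table of
# OFF-summand null readings of def-Y's readers `kernelFamilyS` (G′-type letters) ∕ `kernelFamilyB` (G-type letters)

T. Bałaban, *Propagators for lattice gauge theories in a background field*, Commun. Math. Phys. **99** (1985) 389–434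
[`Balaban1985BackgroundPropagators`, "B9"]; [4] = T. Bałaban, *Propagators and renormalization transformations for lattice
gauge theories. II*, Commun. Math. Phys. **96** (1984) 223–250 [`Balaban1984PropagatorsII`].

statement-level skeleton of published theorems with citation tags; proofs where landed; nothing here is a claim about the
Yang–Mills mass gap

THE PRINTED LOCUS (verbatim).  Corollary 3.5, p. 407: *"This allows us to prove Theorems 3.1–3.3 in some special situations, where
we can use the results of [4]. There we have proved these theorems for operators with the external gauge field configuration U = 1."*;
Thm 3.1 p. 397 is stated for scalar-lattice arguments `λ` of G′(U) (site functions), Thm 3.3 p. 399 for vector arguments of G(U) (bond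
functions); (3.44)–(3.45) p. 398 are the two entries whose right-hand sides carry the Hölder norm `‖λ‖_ε` of (3.40).

THE POINT.  At the Stage-3′(Y) carriers of record the argument type `Loc` of the [B9] geometry `geo9Y x = geo9K x.toKIdx` is a SUM —
torus-SITE functions (arguments of G′) ⊕ fine-BOND functions (arguments of G) — and so is the cut-off type.  NODE 00's seat def-Y typed the
operator layer AS A FUNCTION OF BAŁABAN'S COVARIANT LETTERS (`Node00.OpsYOfLetters`, p464552): a site-sector letter is read by `kernelFamilyS` ON
the site summand and as `0` OFF it, a bond-sector letter by `kernelFamilyB` ON the bond summand and as `0` OFF it (§6 there records four of these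
nulls: `Gp_e_inr`, `GA_e_inl`, `GA_e4_inl`, `GA_h2_inl`).  The knit `Summit.…N06AtRecord11CB10YZW.b9_main_of_up_view₁₁B10YZW_of_obligations`
displays, among the operator layer's obligations, the two NULL READINGS (N06-ASSIGNMENT v1 rows 9–10)
`hE4 : ∀ x lam, ¬ lam.isRight → ∀ y, (ops x).GA.e4 1 lam y ≤ 0` and `hH2 : ∀ x lam, ¬ lam.isRight → ∀ β ζ, (ops x).GA.h2 1 lam β ζ ≤ 0`.
My g0 file `B9Cor35ComparisonsEH` derived them from the comparison rows 6–7 for ANY layer; THIS FILE proves them OUTRIGHT at def-Y's layer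
of letters — at that layer they are definitional (`0 ≤ 0`), for every `𝔏`, `𝔈`, at every background `U` — and completes the OFF-summand table
(the residual rows 11–12, `B9ResidualEntriesAtOneAtLetters` p468918, carry the `≤ 0` forms; the Sect.-B steps consume both):

* §1 G′-sector (`(operatorLayerYOfLetters 𝔸 G x 𝔏 𝔈).Gp = kernelFamilyS … 𝔏.Gp 𝔏.parS`): `Gp_h1_inr`, `Gp_e4_inr`, `Gp_h2_inr`, `Gp_l2_inr`,
  `Gp_glob_inr` (bond ARGUMENT ⇒ `0`), `Gp_h1_inl_inr`, `Gp_h2_inl_inr`, `Gp_l2_inl_inr` (site argument, bond CUT-OFF ⇒ `0`).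
* §2 G-sector (`….GA = kernelFamilyB … 𝔏.GA 𝔏.parB`): `GA_h1_inl`, `GA_l2_inl` (site ARGUMENT ⇒ `0`; the (3.47) slot `GA_glob_inl` is
  dag-n06-g's, `B9Cor35ComparisonsGAAtLetters.GA_glob_inl`, p468508 — not restated), `GA_h1_inr_inl`, `GA_h2_inr_inl`, `GA_l2_inr_inl` (bond
  argument, site CUT-OFF ⇒ `0`); the `isRight`-forms at every `U` are `B9ResidualEntriesAtOneAtLetters.GA_e4∕h2_nonpos_of_not_isRight`
  (p468918, imported).
* §3 AT THE RECORD `ops := opsYOfLetters N θ M⋆ 𝔏 𝔈`: ★★ `hE4_opsYOfLetters`, ★★ `hH2_opsYOfLetters` — conclusions LITERALLY the knit binders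
  `hE4` ∕ `hH2` at that `ops`, NO hypothesis beyond the section variables `𝔏 𝔈` (rows 6–7 are not used at this layer).

HONEST SCOPE.  Rows 9–10 are DISCHARGED AT THE LAYER OF LETTERS by unfolding def-Y's readers; nothing of [B9] or [4] is asserted; the letters
are NOT constructed here (def-Y's successor item `lettersYOfRecord`); count-neutral; N06 NOT discharged; one finite lattice programme — nothing
continuum, nothing about the mass gap.  Cell `pub-ymgap` (HUMAN RULING D-0062), Track A node N06 [B9], N06-ASSIGNMENT v1 rows 9–10 (bundle F3)
at def-Y's instance, seat `pub-ymgap-dag-n06-h` (g2), 2026-08-26.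
-/

noncomputable section

namespace Literature.MathematicalPhysics.QuantumFieldTheory.Balaban1983to89.B9Cor35ComparisonsEHAtLetters

open B9PinMembersKLevelV1 (MemberY geo9Y bg9Y)
open B9PinCarriersKLevelV1 (OperatorLayerY)
open B7Prop2SpecialUnitary (specialUnitaryUnits)
open Node00

variable {d ℓ : ℕ} {hd : 1 ≤ d + 1} {hL : Odd (ℓ + 1) ∧ 1 < ℓ + 1} {b₀ b₁ : ℝ} {Mstar : ℕ}
variable {𝔸 : Type} [NormedRing 𝔸] [NormedAlgebra ℂ 𝔸] [CompleteSpace 𝔸]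

/-! ## §1 The G′-sector reader OFF the site summand -/

section SiteSector

variable {G : Subgroup 𝔸ˣ} (x : MemberY d ℓ hd hL b₀ b₁ Mstar) (𝔏 : CovLettersY 𝔸 x) (𝔈 : ExpLettersY 𝔸 G x)

/-- OFF the site summand the (3.43) Hölder slot of G′'s reading is `0` (bond argument, any cut-off).
[cite: Balaban1985BackgroundPropagators, Thm 3.1 (3.43) p.398 (λ scalar), bookkeeping] -/
theorem Gp_h1_inr (U : (bg9Y 𝔸 G x).Cfg) (J : FBondY x.toKIdx → ℝ) (α : ℝ) (ζ : (geo9Y x).Cut) :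
    (operatorLayerYOfLetters 𝔸 G x 𝔏 𝔈).Gp.h1 U (Sum.inr J) α ζ = 0 := by
  cases ζ <;> rfl

/-- a site argument with a BOND cut-off: the (3.43) slot of G′'s reading is `0`.
[cite: Balaban1985BackgroundPropagators, Thm 3.1 (3.43) p.398 (ζ on sites), bookkeeping] -/
theorem Gp_h1_inl_inr (U : (bg9Y 𝔸 G x).Cfg) (f : SiteY x.toKIdx → ℝ) (α : ℝ) (z : FBondY x.toKIdx → ℝ) :
    (operatorLayerYOfLetters 𝔸 G x 𝔏 𝔈).Gp.h1 U (Sum.inl f) α (Sum.inr z) = 0 := rfl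

/-- OFF the site summand the (3.44) quantity of G′'s reading is `0`. [cite: Balaban1985BackgroundPropagators, Thm 3.1 (3.44) p.398 (λ scalar), bookkeeping] -/
theorem Gp_e4_inr (U : (bg9Y 𝔸 G x).Cfg) (J : FBondY x.toKIdx → ℝ) (y : (geo9Y x).Site) :
    (operatorLayerYOfLetters 𝔸 G x 𝔏 𝔈).Gp.e4 U (Sum.inr J) y = 0 := rfl

/-- OFF the site summand the (3.45) Hölder slot of G′'s reading is `0` (bond argument, any cut-off).
[cite: Balaban1985BackgroundPropagators, Thm 3.1 (3.45) p.398 (λ scalar), bookkeeping] -/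
theorem Gp_h2_inr (U : (bg9Y 𝔸 G x).Cfg) (J : FBondY x.toKIdx → ℝ) (α : ℝ) (ζ : (geo9Y x).Cut) :
    (operatorLayerYOfLetters 𝔸 G x 𝔏 𝔈).Gp.h2 U (Sum.inr J) α ζ = 0 := by
  cases ζ <;> rfl

/-- a site argument with a BOND cut-off: the (3.45) slot of G′'s reading is `0`.
[cite: Balaban1985BackgroundPropagators, Thm 3.1 (3.45) p.398 (ζ on sites), bookkeeping] -/
theorem Gp_h2_inl_inr (U : (bg9Y 𝔸 G x).Cfg) (f : SiteY x.toKIdx → ℝ) (α : ℝ) (z : FBondY x.toKIdx → ℝ) :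
    (operatorLayerYOfLetters 𝔸 G x 𝔏 𝔈).Gp.h2 U (Sum.inl f) α (Sum.inr z) = 0 := rfl

/-- OFF the site summand the six (3.46) `L²` quantities of G′'s reading are `0` (bond argument, any cut-off `h`).
[cite: Balaban1985BackgroundPropagators, Thm 3.1 (3.46) p.398 (λ scalar), bookkeeping] -/
theorem Gp_l2_inr (n : Fin 6) (U : (bg9Y 𝔸 G x).Cfg) (J : FBondY x.toKIdx → ℝ) (h : (geo9Y x).Cut) :
    (operatorLayerYOfLetters 𝔸 G x 𝔏 𝔈).Gp.l2 n U (Sum.inr J) h = 0 := by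
  cases h <;> rfl

/-- a site argument with a BOND cut-off `h`: the (3.46) quantities of G′'s reading are `0`.
[cite: Balaban1985BackgroundPropagators, Thm 3.1 (3.46) p.398 (h on sites), bookkeeping] -/
theorem Gp_l2_inl_inr (n : Fin 6) (U : (bg9Y 𝔸 G x).Cfg) (f : SiteY x.toKIdx → ℝ) (hh : FBondY x.toKIdx → ℝ) :
    (operatorLayerYOfLetters 𝔸 G x 𝔏 𝔈).Gp.l2 n U (Sum.inl f) (Sum.inr hh) = 0 := rfl

/-- OFF the site summand the four (3.47) weighted quantities of G′'s reading are `0`.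
[cite: Balaban1985BackgroundPropagators, Thm 3.1 (3.47) p.398 (λ scalar), bookkeeping] -/
theorem Gp_glob_inr (n : Fin 4) (U : (bg9Y 𝔸 G x).Cfg) (J : FBondY x.toKIdx → ℝ) (γ : ℝ) :
    (operatorLayerYOfLetters 𝔸 G x 𝔏 𝔈).Gp.glob n U (Sum.inr J) γ = 0 := rfl

end SiteSector

/-! ## §2 The G-sector reader OFF the bond summand -/

section BondSector

variable {G : Subgroup 𝔸ˣ} (x : MemberY d ℓ hd hL b₀ b₁ Mstar) (𝔏 : CovLettersY 𝔸 x) (𝔈 : ExpLettersY 𝔸 G x)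

/-- OFF the bond summand the (3.43) Hölder slot of G's reading is `0` (site argument, any cut-off).
[cite: Balaban1985BackgroundPropagators, Thm 3.3 p.399 + (3.43) p.398 (λ vector), bookkeeping] -/
theorem GA_h1_inl (U : (bg9Y 𝔸 G x).Cfg) (f : SiteY x.toKIdx → ℝ) (α : ℝ) (ζ : (geo9Y x).Cut) :
    (operatorLayerYOfLetters 𝔸 G x 𝔏 𝔈).GA.h1 U (Sum.inl f) α ζ = 0 := by
  cases ζ <;> rfl

/-- a bond argument with a SITE cut-off: the (3.43) slot of G's reading is `0`.
[cite: Balaban1985BackgroundPropagators, Thm 3.3 p.399 + (3.43) p.398 (ζ on bonds), bookkeeping] -/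
theorem GA_h1_inr_inl (U : (bg9Y 𝔸 G x).Cfg) (J : FBondY x.toKIdx → ℝ) (α : ℝ) (z : SiteY x.toKIdx → ℝ) :
    (operatorLayerYOfLetters 𝔸 G x 𝔏 𝔈).GA.h1 U (Sum.inr J) α (Sum.inl z) = 0 := rfl

/-- a bond argument with a SITE cut-off: the (3.45) slot of G's reading is `0`.
[cite: Balaban1985BackgroundPropagators, Thm 3.3 p.399 + (3.45) p.398 (ζ on bonds), bookkeeping] -/
theorem GA_h2_inr_inl (U : (bg9Y 𝔸 G x).Cfg) (J : FBondY x.toKIdx → ℝ) (α : ℝ) (z : SiteY x.toKIdx → ℝ) :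
    (operatorLayerYOfLetters 𝔸 G x 𝔏 𝔈).GA.h2 U (Sum.inr J) α (Sum.inl z) = 0 := rfl

/-- OFF the bond summand the six (3.46) `L²` quantities of G's reading are `0` (site argument, any cut-off).
[cite: Balaban1985BackgroundPropagators, Thm 3.3 p.399 + (3.46) p.398 (λ vector), bookkeeping] -/
theorem GA_l2_inl (n : Fin 6) (U : (bg9Y 𝔸 G x).Cfg) (f : SiteY x.toKIdx → ℝ) (h : (geo9Y x).Cut) :
    (operatorLayerYOfLetters 𝔸 G x 𝔏 𝔈).GA.l2 n U (Sum.inl f) h = 0 := by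
  cases h <;> rfl

/-- a bond argument with a SITE cut-off `h`: the (3.46) quantities of G's reading are `0`.
[cite: Balaban1985BackgroundPropagators, Thm 3.3 p.399 + (3.46) p.398 (h on bonds), bookkeeping] -/
theorem GA_l2_inr_inl (n : Fin 6) (U : (bg9Y 𝔸 G x).Cfg) (J : FBondY x.toKIdx → ℝ) (hh : SiteY x.toKIdx → ℝ) :
    (operatorLayerYOfLetters 𝔸 G x 𝔏 𝔈).GA.l2 n U (Sum.inr J) (Sum.inl hh) = 0 := rfl

end BondSector

/-! ## §3 At the record: the knit binders `hE4`, `hH2` at `ops := opsYOfLetters N θ M⋆ 𝔏 𝔈` -/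

section Record

open scoped Matrix.Norms.L2Operator

variable (N : ℕ) (θ : Stage3Params) (Mstar' : ℕ) (𝔏 : LettersY N θ Mstar') (𝔈 : ExpsY N θ Mstar')

/-- ★★ **THE KNIT BINDER `hE4` AT NODE 00's OPERATOR LAYER OF LETTERS** — for EVERY family of letter records `𝔏` and expansion letters `𝔈`: at
`ops := opsYOfLetters N θ M⋆ 𝔏 𝔈` the null reading of G(1)'s (3.44) quantity off the bond summand holds at every member — LITERALLY the binder
`hE4` of `Summit.…b9_main_of_up_view₁₁B10YZW_of_obligations` ∕ `B9PinCarriersKLevelV1.b9LeafX_carriersY` at that `ops`; no hypothesis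
(N06-ASSIGNMENT v1 row 9, DISCHARGED at the layer of letters). [cite: Balaban1985BackgroundPropagators, Cor. 3.5 p.407 + (3.44) p.398] -/
theorem hE4_opsYOfLetters :
    ∀ (x : MemberY θ.d₆ θ.ℓ₆ θ.hd' θ.hL' θ.b₀ θ.b₁ Mstar') (lam : (geo9Y x).Loc), ¬ (lam.isRight = true) →
      ∀ (y : (geo9Y x).Site),
        (opsYOfLetters N θ Mstar' 𝔏 𝔈 x).GA.e4 (bg9Y (Matrix (Fin N) (Fin N) ℂ) (specialUnitaryUnits (Fin N)) x).one lam y ≤ 0 :=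
  fun x lam h y => B9ResidualEntriesAtOneAtLetters.GA_e4_nonpos_of_not_isRight x (𝔏 x) (𝔈 x) _ lam h y

/-- ★★ **THE KNIT BINDER `hH2` AT NODE 00's OPERATOR LAYER OF LETTERS** — LITERALLY `hH2` at `ops := opsYOfLetters N θ M⋆ 𝔏 𝔈`, every `𝔏`, `𝔈`;
no hypothesis (N06-ASSIGNMENT v1 row 10, DISCHARGED at the layer of letters). [cite: Balaban1985BackgroundPropagators, Cor. 3.5 p.407 + (3.45) p.398] -/
theorem hH2_opsYOfLetters :
    ∀ (x : MemberY θ.d₆ θ.ℓ₆ θ.hd' θ.hL' θ.b₀ θ.b₁ Mstar') (lam : (geo9Y x).Loc), ¬ (lam.isRight = true) →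
      ∀ (β : ℝ) (c : (geo9Y x).Cut),
        (opsYOfLetters N θ Mstar' 𝔏 𝔈 x).GA.h2 (bg9Y (Matrix (Fin N) (Fin N) ℂ) (specialUnitaryUnits (Fin N)) x).one lam β c ≤ 0 :=
  fun x lam h β c => B9ResidualEntriesAtOneAtLetters.GA_h2_nonpos_of_not_isRight x (𝔏 x) (𝔈 x) _ lam h β c

end Record

end Literature.MathematicalPhysics.QuantumFieldTheory.Balaban1983to89.B9Cor35ComparisonsEHAtLetters

end
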